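import Summits.CriticalPhenomena.PercolationContinuityZ3.Theorems.PercNearOneGluingNoHeavyLowerTailDualBHKBase
import Summits.CriticalPhenomena.PercolationContinuityZ3.Theorems.PercNearOneGluingNoHeavyLowerTailDualBHKBlock
import Mathlib.Tactic.Linarith
import Mathlib.Tactic.Ring
import HarnessLib

/-!
# Dual BHK inequality — Theorem 1: the family `EA(M; X, Y, N)`

Support file 6/7 for the dual BHK inequality `u_b·u_c ≥ t·n′_a` (memo `prim-ineq-gen-2/DUAL-BHK.md` §8, Theorem 1;
`--supports stmt-CriticalPhenomena-4575`).  For every finite weighted graph (random edges `D`, weights `p ∈ [0,1]`, forced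
edges `F`, support `E ⊇ D ∪ F`), every universe `U ∋ a` and all vertex sets `M ⊆ U`, `X, Y ⊆ N ⊆ U`:

  `ea_univ`:  `t(M,X) · e₂(M;Y,N) ≤ Ξ(M; X ∩ Y) · e₄(X ∪ Y; M)`,

i.e. `P(a, M̂, X̂ joined) · P(C_a meets M, misses Y, separates M from N) ≤ P(C_a meets M, R(M) misses X∩Y) · P(R(X∪Y) meets X∪Y and M)`.
PROOF (memo): strong induction on `U`.  If some `v ∈ X ∩ Y`, `v ∉ M ∪ {a}`: peel `v` (`ad_step` with the four pointwise
translations of file 4 and the induction hypothesis on `U ∖ v`, using `X^K ∪ Y^{K′} = W^{K∪K′}` and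
`X^K ∩ Y^{K′} ⊇ Z^{K∩K′}`).  If `X ∩ Y` meets `M ∪ {a}`: factor 2 vanishes.  If `X ∩ Y = ∅` (base type): with
`h(M) = Ξ(M;X) + α`, `e₂(M;∅,X) = g₁ + g₃`, `t = α + β − θ`, `g₃ ≤ θ ≤ min(α,β)` the claim is
`[Ξ(M;X)β − t g₁] + [αβ − t g₃] ≥ 0`; the first bracket is the non-base instance `EA(M;X,X,X)` on the same `U`, the second is
`≥ (α−θ)(β−θ) ≥ 0`.  [this work]
-/

namespace Summit.CriticalPhenomena.PercolationContinuityZ3.Theorems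

namespace DualBHK

open SimpleGraph Finset Literature.Probability.Percolation.DecisionTree

variable {V : Type*} [DecidableEq V]

/-! ### Two small `PrW` facts -/

section PrWFacts

variable {ι : Type*} [DecidableEq ι] (D : Finset ι) (p : ι → ℝ)

/-- An event with no members has mass `0`. [folklore] -/
theorem PrW_eq_zero_of_forall_not_mem {X : Set (Finset ι)} (h : ∀ S, S ∉ X) : PrW D p X = 0 := by
  rw [Set.eq_empty_of_forall_notMem h]
  unfold PrW
  simp only [Set.indicator_empty, Finset.sum_const_zero]

/-- Inclusion–exclusion for two events. [folklore] -/
theorem PrW_union_add_inter (X Y : Set (Finset ι)) :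
    PrW D p (X ∪ Y) + PrW D p (X ∩ Y) = PrW D p X + PrW D p Y := by
  have h1 : PrW D p (X ∪ Y) = PrW D p X + PrW D p (Y \ X) := by
    rw [← PrW_union D p Set.disjoint_sdiff_right, Set.union_sdiff_self]
  have h2 : PrW D p Y = PrW D p (Y \ X) + PrW D p (X ∩ Y) := by
    rw [← PrW_union D p (Set.disjoint_sdiff_left.mono_right Set.inter_subset_left)]
    congr 1
    ext S
    simp only [Set.mem_union, Set.mem_sdiff, Set.mem_inter_iff]
    tauto
  rw [h1, h2]; ring

end PrWFacts

/-! ### The base-type brackets (memo Lemma E) -/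

section Brackets

variable {D F E : Finset (Sym2 V)} {p : Sym2 V → ℝ} {a : V}

/-- `h(M) = Ξ(M;X) + α` with `α = e₄(M;X)`. [this work] -/
theorem PrW_evXi_empty_split (U : Finset V) (M X : Set V) :
    PrW D p (evXi U F a M ∅) = PrW D p (evXi U F a M X) + PrW D p (evE4 U F a M X) := by
  rw [← PrW_union D p (Set.disjoint_left.2 fun S h1 h2 => not_mem_evXi_and_evE4 M X ⟨h1, h2⟩)]
  congr 1
  ext S
  rw [Set.mem_union]
  exact mem_evXi_empty_iff_or M X

/-- `e₂(M;∅,X) = g₁ + g₃` with `g₁ = e₂(M;X,X)`, `g₃ = P(hM ∧ hX ∧ Sep(M,X))`. [this work] -/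
theorem PrW_evE2_empty_split (U : Finset V) (M X : Set V) :
    PrW D p (evE2 U E F a M ∅ X) = PrW D p (evE2 U E F a M X X) +
      PrW D p {S | (∃ m ∈ M, (sG U (S ∪ F) ∅ ∅).Reachable a m) ∧
        (∃ x ∈ X, (sG U (S ∪ F) ∅ ∅).Reachable a x) ∧ S ∪ F ∈ sepEv U E a M X} := by
  rw [← PrW_union D p (X := evE2 U E F a M X X)
    (Y := {S | (∃ m ∈ M, (sG U (S ∪ F) ∅ ∅).Reachable a m) ∧
        (∃ x ∈ X, (sG U (S ∪ F) ∅ ∅).Reachable a x) ∧ S ∪ F ∈ sepEv U E a M X})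
    (Set.disjoint_left.2 fun S h1 h2 => not_mem_evE2_and_g3 M X ⟨h1, h2⟩)]
  congr 1
  ext S
  rw [Set.mem_union]
  exact mem_evE2_empty_iff_or M X

/-- **The bracket (E-c)**: `t(M,X) · g₃ ≤ α · β` where `α = e₄(M;X)`, `β = e₄(X;M)`, `g₃ = P(hM ∧ hX ∧ Sep(M,X))`;
from `t = α + β − θ`, `g₃ ≤ θ ≤ min(α,β)` (`θ = P(hM ∧ hX)`): `αβ − tθ = (α−θ)(β−θ) ≥ 0`. [this work] -/
theorem t_mul_g3_le (hp0 : ∀ e, 0 ≤ p e) (hp1 : ∀ e, p e ≤ 1) (U : Finset V) (M X : Set V) :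
    PrW D p (evT U F a M X) *
        PrW D p {S | (∃ m ∈ M, (sG U (S ∪ F) ∅ ∅).Reachable a m) ∧
          (∃ x ∈ X, (sG U (S ∪ F) ∅ ∅).Reachable a x) ∧ S ∪ F ∈ sepEv U E a M X} ≤
      PrW D p (evE4 U F a M X) * PrW D p (evE4 U F a X M) := by
  set t := PrW D p (evT U F a M X) with ht_def
  set α := PrW D p (evE4 U F a M X)
  set β := PrW D p (evE4 U F a X M)
  set θ := PrW D p (evE4 U F a M X ∩ evE4 U F a X M) with hθ
  have htαβ : t + θ = α + β := by
    have hU : evT U F a M X = evE4 U F a M X ∪ evE4 U F a X M := by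
      ext S; rw [Set.mem_union]; exact mem_evT_iff_evE4_or M X
    rw [ht_def, hU, hθ]
    exact PrW_union_add_inter D p _ _
  have hg3θ : PrW D p {S | (∃ m ∈ M, (sG U (S ∪ F) ∅ ∅).Reachable a m) ∧
      (∃ x ∈ X, (sG U (S ∪ F) ∅ ∅).Reachable a x) ∧ S ∪ F ∈ sepEv U E a M X} ≤ θ := by
    refine PrW_mono D hp0 hp1 fun S _ hS => ?_
    exact (mem_evE4_and_evE4_iff M X).2 ⟨hS.1, hS.2.1⟩
  have hθα : θ ≤ α := PrW_mono D hp0 hp1 fun S _ hS => hS.1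
  have hθβ : θ ≤ β := PrW_mono D hp0 hp1 fun S _ hS => hS.2
  have ht0 : 0 ≤ t := PrW_nonneg D hp0 hp1 _
  have h1 := mul_le_mul_of_nonneg_left hg3θ ht0
  have h2 : 0 ≤ (α - θ) * (β - θ) := mul_nonneg (sub_nonneg.2 hθα) (sub_nonneg.2 hθβ)
  have h3 : t = α + β - θ := by linarith
  nlinarith

end Brackets

/-! ### Theorem 1 -/

section EA

variable {D F E : Finset (Sym2 V)} {p : Sym2 V → ℝ} {a : V}

/-- **Theorem 1 (family `EA`)** of the memo: `t(M,X) · e₂(M;Y,N) ≤ Ξ(M; X∩Y) · e₄(X∪Y; M)` for all `M ⊆ U`, `X, Y ⊆ N ⊆ U`,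
`a ∈ U`. [this work] -/
theorem ea_univ (hp0 : ∀ e, 0 ≤ p e) (hp1 : ∀ e, p e ≤ 1) (hDE : D ⊆ E) (hFE : F ⊆ E) (U : Finset V) :
    ∀ (M X Y N : Set V), a ∈ U → M ⊆ ↑U → N ⊆ ↑U → X ⊆ N → Y ⊆ N →
      PrW D p (evT U F a M X) * PrW D p (evE2 U E F a M Y N) ≤
        PrW D p (evXi U F a M (X ∩ Y)) * PrW D p (evE4 U F a (X ∪ Y) M) := by
  induction U using Finset.strongInduction with
  | H U ih =>
  -- nonnegativity of all masses
  have hnn : ∀ X : Set (Finset (Sym2 V)), 0 ≤ PrW D p X := fun X => PrW_nonneg D hp0 hp1 X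
  /- Step 1: `X ∩ Y ≠ ∅` — peel a vertex of `X ∩ Y ∖ (M ∪ {a})`, or factor 2 vanishes. -/
  have step : ∀ (M X Y N : Set V), a ∈ U → M ⊆ ↑U → N ⊆ ↑U → X ⊆ N → Y ⊆ N → (X ∩ Y).Nonempty →
      PrW D p (evT U F a M X) * PrW D p (evE2 U E F a M Y N) ≤
        PrW D p (evXi U F a M (X ∩ Y)) * PrW D p (evE4 U F a (X ∪ Y) M) := by
    intro M X Y N haU hMU hNU hXN hYN ⟨v, hvX, hvY⟩
    have hRHS : 0 ≤ PrW D p (evXi U F a M (X ∩ Y)) * PrW D p (evE4 U F a (X ∪ Y) M) :=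
      mul_nonneg (hnn _) (hnn _)
    by_cases hva : v = a
    · -- `a ∈ Y` is avoided: factor 2 vanishes
      subst hva
      rw [PrW_eq_zero_of_forall_not_mem D p (fun S => not_mem_evE2_of_mem (U := U) (E := E) (F := F) hvY S),
        mul_zero]
      exact hRHS
    by_cases hvM : v ∈ M
    · -- `v ∈ M ∩ N` avoided while separated: factor 2 vanishes
      rw [PrW_eq_zero_of_forall_not_mem D p
        (fun S => not_mem_evE2_of_mem_inter (U := U) (E := E) (F := F) (a := a) hvY hvM (hYN hvY) S), mul_zero]
      exact hRHS
    -- peel `v`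
    have hav : a ≠ v := fun h => hva h.symm
    have hvN : v ∈ N := hYN hvY
    have hvU : v ∈ U := hNU hvN
    have hss : U.erase v ⊂ U := Finset.erase_ssubset hvU
    have haU' : a ∈ U.erase v := Finset.mem_erase.2 ⟨hav, haU⟩
    have hMU' : M ⊆ ↑(U.erase v) := fun m hm => by
      rw [Finset.coe_erase]; exact ⟨hMU hm, fun h => hvM (by rw [Set.mem_singleton_iff.1 h] at hm; exact hm)⟩
    have hN1 : (N \ {v}) ∪ Kset U E v ⊆ ↑(U.erase v) := by
      rintro d (⟨hdN, hdv⟩ | hdK)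
      · rw [Finset.coe_erase]; exact ⟨hNU hdN, hdv⟩
      · rw [Finset.coe_erase]; exact ⟨hdK.1, fun h => hdK.2.1 (Set.mem_singleton_iff.1 h)⟩
    refine ad_step hp0 hp1 hDE hFE U v _ _ _ _
      (fun K => evT (U.erase v) F a M ((X \ {v}) ∪ K))
      (fun K => evE2 (U.erase v) E F a M ((Y \ {v}) ∪ K) ((N \ {v}) ∪ Kset U E v))
      (fun K => evXi (U.erase v) F a M (((X ∩ Y) \ {v}) ∪ K))
      (fun K => evE4 (U.erase v) F a (((X ∪ Y) \ {v}) ∪ K) M)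
      (fun S _ => mem_evT_peel_iff hvU hav hvX hvM)
      (fun S _ => mem_evE2_peel_iff hvU hav hvY hvM hvN)
      (fun S _ => mem_evXi_peel_avoid_iff hvU hav ⟨hvX, hvY⟩ hvM)
      (fun S _ => mem_evE4_peel_iff hvU hav (Or.inl hvX) hvM)
      (fun K T R hT => union_mem_evT_erase_iff hT R M _)
      (fun K T R hT => union_mem_evE2_erase_iff hT R M _ _)
      (fun K T R hT => union_mem_evXi_erase_iff hT R M _)
      (fun K T R hT => union_mem_evE4_erase_iff hT R _ M)
      ?_
    intro K K' hK hK'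
    -- the induction hypothesis on `U ∖ v` with `X^K`, `Y^{K'}`, `N₁`
    have hX1 : (X \ {v}) ∪ K ⊆ (N \ {v}) ∪ Kset U E v :=
      Set.union_subset_union (Set.sdiff_subset_sdiff_left hXN) hK
    have hY1 : (Y \ {v}) ∪ K' ⊆ (N \ {v}) ∪ Kset U E v :=
      Set.union_subset_union (Set.sdiff_subset_sdiff_left hYN) hK'
    have IH := ih (U.erase v) hss M ((X \ {v}) ∪ K) ((Y \ {v}) ∪ K') ((N \ {v}) ∪ Kset U E v)
      haU' hMU' hN1 hX1 hY1
    -- compare the right-hand sides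
    have h3 : PrW D p (evXi (U.erase v) F a M (((X \ {v}) ∪ K) ∩ ((Y \ {v}) ∪ K'))) ≤
        PrW D p (evXi (U.erase v) F a M (((X ∩ Y) \ {v}) ∪ (K ∩ K'))) := by
      refine PrW_mono D hp0 hp1 fun S _ hS => evXi_anti ?_ hS
      rintro d (⟨⟨hdX, hdY⟩, hdv⟩ | ⟨hdK, hdK'⟩)
      · exact ⟨Or.inl ⟨hdX, hdv⟩, Or.inl ⟨hdY, hdv⟩⟩
      · exact ⟨Or.inr hdK, Or.inr hdK'⟩
    have h4 : evE4 (U.erase v) F a (((X \ {v}) ∪ K) ∪ ((Y \ {v}) ∪ K')) M =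
        evE4 (U.erase v) F a (((X ∪ Y) \ {v}) ∪ (K ∪ K')) M := by
      congr 1
      ext d
      simp only [Set.mem_union, Set.mem_sdiff, Set.mem_singleton_iff]
      tauto
    rw [← h4]
    exact IH.trans (mul_le_mul_of_nonneg_right h3 (hnn _))
  /- Step 2: all parameters. -/
  intro M X Y N haU hMU hNU hXN hYN
  by_cases hZ : (X ∩ Y).Nonempty
  · exact step M X Y N haU hMU hNU hXN hYN hZ
  have hZe : X ∩ Y = ∅ := Set.not_nonempty_iff_eq_empty.1 hZ
  rw [hZe]
  have hXU : X ⊆ ↑U := hXN.trans hNU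
  -- names
  set t := PrW D p (evT U F a M X) with ht_def
  set α := PrW D p (evE4 U F a M X) with hα
  set β := PrW D p (evE4 U F a X M) with hβ
  set Ξ := PrW D p (evXi U F a M X) with hΞ
  set g₁ := PrW D p (evE2 U E F a M X X) with hg₁
  set g₃ := PrW D p {S | (∃ m ∈ M, (sG U (S ∪ F) ∅ ∅).Reachable a m) ∧
      (∃ x ∈ X, (sG U (S ∪ F) ∅ ∅).Reachable a x) ∧ S ∪ F ∈ sepEv U E a M X} with hg₃
  have ht0 : 0 ≤ t := hnn _
  -- monotone bounds on factors 2 and 4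
  have h2 : PrW D p (evE2 U E F a M Y N) ≤ PrW D p (evE2 U E F a M ∅ X) :=
    PrW_mono D hp0 hp1 fun S _ hS => evE2_anti (Set.empty_subset Y) hXN hS
  have h4 : β ≤ PrW D p (evE4 U F a (X ∪ Y) M) :=
    PrW_mono D hp0 hp1 fun S _ hS => evE4_mono Set.subset_union_left hS
  -- the two splits
  have hs3 : PrW D p (evXi U F a M ∅) = Ξ + α := PrW_evXi_empty_split U M X
  have hs2 : PrW D p (evE2 U E F a M ∅ X) = g₁ + g₃ := PrW_evE2_empty_split U M X
  -- (i) the non-base instance `EA(M;X,X,X)` on the same universe: `t g₁ ≤ Ξ β`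
  have hi : t * g₁ ≤ Ξ * β := by
    by_cases hXe : X.Nonempty
    · have h := step M X X X haU hMU hXU le_rfl le_rfl (by rwa [Set.inter_self])
      rwa [Set.inter_self, Set.union_self] at h
    · have hXe' : X = ∅ := Set.not_nonempty_iff_eq_empty.1 hXe
      have ht0' : t = 0 := by
        rw [ht_def]
        refine PrW_eq_zero_of_forall_not_mem D p fun S hS => ?_
        obtain ⟨x, hx, _⟩ := hS.2
        rw [hXe'] at hx
        exact hx
      rw [ht0', zero_mul]
      exact mul_nonneg (hnn _) (hnn _)
  -- (ii) the algebraic bracket `t g₃ ≤ α β`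
  have hii : t * g₃ ≤ α * β := t_mul_g3_le hp0 hp1 U M X
  -- assemble
  calc t * PrW D p (evE2 U E F a M Y N)
      ≤ t * (g₁ + g₃) := by rw [← hs2]; exact mul_le_mul_of_nonneg_left h2 ht0
    _ = t * g₁ + t * g₃ := by ring
    _ ≤ Ξ * β + α * β := add_le_add hi hii
    _ = PrW D p (evXi U F a M ∅) * β := by rw [hs3]; ring
    _ ≤ PrW D p (evXi U F a M ∅) * PrW D p (evE4 U F a (X ∪ Y) M) :=
        mul_le_mul_of_nonneg_left h4 (hnn _)

end EA

end DualBHK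

end Summit.CriticalPhenomena.PercolationContinuityZ3.Theorems
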